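import Literature.MathematicalPhysics.QuantumLattice.QuasiLocalAverageProofs
import Literature.MathematicalPhysics.QuantumLattice.StabilityTorusGeometryProofs
import HarnessLib

/-!
# Radius-indexed pieces of an observable from its twirl localisation errors

Top-down layer (seat B) of the formalisation of the Michalakis–Zwolak stability theorem
(hubbard.S19, `Literature.MathematicalPhysics.QuantumLattice.michalakis_zwolak`). The reductions of
this line (`michalakis_zwolak_of_flow_locality_core`, `…_of_termwise_core`) ask for each rotated
term to be written as `Σ_{i ≤ L} A i` with `A i` Hermitian, supported in the ball `cellBall x i`,
and bounded. The Lieb–Robinson layers (seat A: `QuasiLocalAverageProofs`,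
`SmoothingLocalityProofs`, `FlowQuasiLocalityProofs`) deliver instead **localisation errors**
`‖F − 𝔼_{b_x(r+ℓ)ᶜ}(F)‖ ≤ err ℓ` for the finite twirl `𝔼` (BMNS `Δ`-decomposition,
arXiv:1102.0842 p. 13; MZ13 Lemma 1 (iv), Lemma 2: "`𝓕(O_u(r)) = Σ_{r'} 𝓕(r'; O_u(r))`"). This
file performs the conversion once and for all (`exists_ball_pieces_of_twirl_errors`): with
`T_i = 𝔼_{b_x(i)ᶜ}(F)`, the pieces `A i = 0` (`i < r`), `A r = T_r`, `A i = T_i − T_{i−1}`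
(`r < i ≤ L`) telescope to `T_L = F` (the ball of radius `L` is the whole torus), are Hermitian
(`twirl_conjTranspose`), supported in `cellBall x i`, and satisfy `‖A r‖ ≤ ‖F‖`,
`‖A (r+ℓ+1)‖ ≤ err (ℓ+1) + err ℓ`. No definitions, no named facts (theorems only).
-/

noncomputable section

open Matrix Finset
open scoped Matrix.Norms.L2Operator

namespace Literature.MathematicalPhysics.QuantumLattice

open Literature.Probability.LatticeModels

section Twirl

variable {Λ : Type*} [Fintype Λ] [DecidableEq Λ] {q : ℕ}

/-- **The twirl commutes with the adjoint**: `(𝔼_S(M))ᴴ = 𝔼_S(Mᴴ)` (an average of unitary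
conjugates with a real normalisation); in particular the twirl of a Hermitian observable is
Hermitian. [folklore] -/
theorem twirl_conjTranspose (S : Finset Λ) (M : Op Λ q) : (twirl S M)ᴴ = twirl S Mᴴ := by
  simp only [twirl, conjTranspose_smul, conjTranspose_sum, conjTranspose_mul,
    conjTranspose_conjTranspose, Matrix.mul_assoc]
  congr 1
  rw [star_inv₀, star_natCast]

/-- The twirl of a Hermitian observable is Hermitian. [folklore] -/
theorem isHermitian_twirl (S : Finset Λ) {M : Op Λ q} (hM : M.IsHermitian) :
    (twirl S M).IsHermitian := by
  rw [IsHermitian, twirl_conjTranspose, hM.eq]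

end Twirl

section Pieces

variable {d L : ℕ} [NeZero L] {κ : Type*} [Fintype κ] [DecidableEq κ] {q : ℕ}

/-- **Radius-indexed pieces from twirl localisation errors.** Let `F` be a Hermitian observable
on the decorated torus, `x` a centre, `r ≤ L` a base radius and `err ℓ` bounds for the
localisation errors `‖F − 𝔼_{(cellBall x (r+ℓ))ᶜ}(F)‖ ≤ err ℓ`. Then there are pieces `A i`,
`i ≤ L`, with `Σ_{i ≤ L} A i = F`, `A i` Hermitian and supported in `cellBall x i`, `A i = 0` for
`i < r`, `‖A r‖ ≤ ‖F‖`, and `‖A (r + ℓ + 1)‖ ≤ err (ℓ + 1) + err ℓ` (the telescoping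
`Δ`-decomposition of BMNS/MZ13 Lemma 1 (iv), `eq_twirl_add_sum_range_sub`, re-indexed by the
absolute radius). [cite: MichalakisZwolakCMP2013, §5.1 Lemma 1 (iv) (arXiv:1109.1588 pp. 9–10)] -/
theorem exists_ball_pieces_of_twirl_errors (x : TorusSite d L) {r : ℕ} (hr : r ≤ L)
    {F : Op (TorusSite d L × κ) q} (hF : F.IsHermitian) {err : ℕ → ℝ}
    (herr : ∀ ℓ, ‖F - twirl (cellBall x (r + ℓ) : Finset (TorusSite d L × κ))ᶜ F‖ ≤ err ℓ) :
    ∃ A : ℕ → Op (TorusSite d L × κ) q,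
      (∑ i ∈ range (L + 1), A i = F) ∧
      (∀ i, (A i).IsHermitian) ∧
      (∀ i, IsSupportedOn (A i) (cellBall x i)) ∧
      (∀ i, i < r → A i = 0) ∧
      ‖A r‖ ≤ ‖F‖ ∧
      (∀ ℓ, ‖A (r + ℓ + 1)‖ ≤ err (ℓ + 1) + err ℓ) := by
  classical
  set T : ℕ → Op (TorusSite d L × κ) q :=
    fun i => twirl (cellBall x i : Finset (TorusSite d L × κ))ᶜ F with hTdef
  set A : ℕ → Op (TorusSite d L × κ) q :=
    fun i => if i < r then 0 else if i = r then T r else T i - T (i - 1) with hAdef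
  have hAlt : ∀ i, i < r → A i = 0 := fun i hi => by simp [hAdef, hi]
  have hAr : A r = T r := by simp [hAdef]
  have hAsucc : ∀ ℓ, A (r + ℓ + 1) = T (r + ℓ + 1) - T (r + ℓ) := by
    intro ℓ
    have h1 : ¬ r + ℓ + 1 < r := by omega
    have h2 : r + ℓ + 1 ≠ r := by omega
    simp only [hAdef, h1, h2, if_false, Nat.add_sub_cancel]
  have hTL : T L = F := by
    simp only [hTdef, cellBall_eq_univ_of_half_le x (Nat.div_le_self L 2), compl_univ, twirl_empty]
  refine ⟨A, ?_, ?_, ?_, hAlt, ?_, ?_⟩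
  -- (1) telescoping
  · obtain ⟨k, hk⟩ : ∃ k, L + 1 = r + (k + 1) := ⟨L - r, by omega⟩
    rw [hk, Finset.sum_range_add, Finset.sum_eq_zero (fun i hi => hAlt i (mem_range.mp hi)),
      zero_add, Finset.sum_range_succ', add_zero, hAr]
    have h1 : ∀ j ∈ range k, A (r + (j + 1)) = T (r + (j + 1)) - T (r + j) := fun j _ => by
      rw [← add_assoc]; exact hAsucc j
    rw [sum_congr rfl h1, Finset.sum_range_sub (fun j => T (r + j)), add_zero, sub_add_cancel]
    have hL : r + k = L := by omega
    rw [hL, hTL]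
  -- (2) hermiticity
  · intro i
    simp only [hAdef]
    split_ifs
    · exact isHermitian_zero
    · exact isHermitian_twirl _ hF
    · exact (isHermitian_twirl _ hF).sub (isHermitian_twirl _ hF)
  -- (3) supports
  · intro i
    simp only [hAdef]
    split_ifs with h1 h2
    · exact IsSupportedOn.zero _
    · subst h2; exact isSupportedOn_twirl_compl _ F
    · exact isSupportedOn_twirl_compl_sub (cellBall_mono x (Nat.sub_le i 1)) F
  -- (5) the base piece
  · rw [hAr]; exact norm_twirl_le _ F
  -- (6) the telescoping pieces
  · intro ℓ
    rw [hAsucc]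
    calc ‖T (r + ℓ + 1) - T (r + ℓ)‖
        ≤ ‖F - T (r + ℓ + 1)‖ + ‖F - T (r + ℓ)‖ := norm_twirl_sub_twirl_le _ _ F
      _ ≤ err (ℓ + 1) + err ℓ := add_le_add (by rw [add_assoc]; exact herr (ℓ + 1)) (herr ℓ)

end Pieces

end Literature.MathematicalPhysics.QuantumLattice
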